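import Summits.BirchSwinnertonDyer.BirchSwinnertonDyer.Theses.SemiOrdinaryEisensteinDescent
import Literature.NumberTheory.EllipticCurves.GaloisImageLiftingLevelPSquaredProofs
import HarnessLib

/-!
# Route `SemiOrdinaryEisensteinDescent`, crux Ko `WildKolyvaginUpperAtThree` (stmt-BirchSwinnertonDyer-20480) and residual NT
# `WildRankOneSurjNonTowerAtThree` (stmt-20484): the `3`-adic TOWER binder `AdditiveThree.TowerSurjThree W` IS «onto mod `9`»
# (lead prover bsd-wall-soed-p2 g2; `--supports stmt-BirchSwinnertonDyer-20480`, helper; BSD is not proved by any of this)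

Ko carries the binder `AdditiveThree.TowerSurjThree W` («`ρ_{E,3^n}` onto for all `n ≥ 1`», the McCallum/Kolyvagin image
hypothesis at `p = 3`, USED by line `birth` v3's composition p581112), and the route's residual NT is typed `¬ TowerSurjThree W` with
the informal gloss «`ρ̄_{E,3}` onto but `ρ_{E,9}` not onto: Elkies' mod-9 defects». The gloss is Serre's lifting lemma started at
level `9` — in the tree only for `p ≥ 5` from level `p` (`serre_hasSurjectiveModNGaloisRep_pow_holds`) and for `p = 2` from level
`8` until today. With the Literature theorem `hasSurjectiveModNGaloisRep_three_pow_of_nine` (this seat, p586121: `ρ̄_{E,9}` onto ⟹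
`ρ̄_{E,3^n}` onto for every `n`, over any field of characteristic `≠ 3`, from the tree's level-`p²` group lemma
`Serre1968.generalLinearGroup_eq_top_of_map_sq_surjective`) the tower binder becomes a finite, census-checkable condition:
* `towerSurjThree_of_hasSurjectiveModNGaloisRep_nine` / `towerSurjThree_iff_hasSurjectiveModNGaloisRep_nine` —
  `TowerSurjThree W ↔ ρ̄_{E,9} onto` for every elliptic `W/ℚ`;
* `not_towerSurjThree_iff` — NT's binder `¬ TowerSurjThree W` IS «not onto mod `9`» (so NT's habitat is exactly the Elkies rows,
  as its text says, and the census's MOD9 flag books the tower rows soundly).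
References: [SerreAbelianLadic1968] IV §3.4 Lemma 3 + Exercises; [Elkies2006ThreeAdic] §0; [DokchitserDokchitserMathZ2012] Introduction.
-/

set_option autoImplicit false
set_option linter.dupNamespace false -- `Summit.BirchSwinnertonDyer.BirchSwinnertonDyer.…` is the tree's layout (D-0017)

noncomputable section

open scoped Classical

namespace Summit.BirchSwinnertonDyer.BirchSwinnertonDyer.Theorems.TowerSurjThreeOfModNine

open WeierstrassCurve Literature.NumberTheory.EllipticCurves Summit.BirchSwinnertonDyer.Rank1Residual
  Summit.BirchSwinnertonDyer.Rank1Residual.Additive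
  Summit.BirchSwinnertonDyer.BirchSwinnertonDyer.Theses.SemiOrdinaryEisensteinDescent

/-- **Onto mod `9` ⟹ the `3`-adic tower** (`AdditiveThree.TowerSurjThree W`), for every elliptic `W/ℚ`: Serre's lifting lemma
from level `9` (`hasSurjectiveModNGaloisRep_three_pow_of_nine`). [cite: SerreAbelianLadic1968, Ch. IV §3.4, Lemma 3 and Exercises] -/
theorem towerSurjThree_of_hasSurjectiveModNGaloisRep_nine (W : WeierstrassCurve ℚ) [W.IsElliptic]
    (h9 : W.HasSurjectiveModNGaloisRep 9) : AdditiveThree.TowerSurjThree W := by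
  intro n _
  have h := hasSurjectiveModNGaloisRep_three_pow_of_nine W (by norm_num) h9 n
  exact_mod_cast h

/-- **The `3`-adic tower IS «onto mod `9`»** (`TowerSurjThree W ↔ ρ̄_{E,9}` onto; `→` is the level `n = 2`).
[cite: SerreAbelianLadic1968, Ch. IV §3.4, Lemma 3 and Exercises] [cite: Elkies2006ThreeAdic, §0] -/
theorem towerSurjThree_iff_hasSurjectiveModNGaloisRep_nine (W : WeierstrassCurve ℚ) [W.IsElliptic] :
    AdditiveThree.TowerSurjThree W ↔ W.HasSurjectiveModNGaloisRep 9 := by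
  refine ⟨fun h ↦ ?_, towerSurjThree_of_hasSurjectiveModNGaloisRep_nine W⟩
  have h2 := h 2 (by norm_num)
  norm_num at h2
  exact h2

/-- **NT's binder**: `¬ TowerSurjThree W ↔ ρ̄_{E,9}` NOT onto — the residual `WildRankOneSurjNonTowerAtThree` (stmt-20484) lives exactly on
the onto-mod-`3`-not-mod-`9` (Elkies) rows, as its text says. [cite: Elkies2006ThreeAdic, §0] -/
theorem not_towerSurjThree_iff (W : WeierstrassCurve ℚ) [W.IsElliptic] :
    ¬ AdditiveThree.TowerSurjThree W ↔ ¬ W.HasSurjectiveModNGaloisRep 9 :=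
  not_congr (towerSurjThree_iff_hasSurjectiveModNGaloisRep_nine W)

/-! ## The residual NT BY NAME ⟺ its mod-`9` form -/

/-- **NT `WildRankOneSurjNonTowerAtThree` (stmt-20484) BY NAME ⟸ its census form** («onto mod `3`, NOT onto mod `9`, wild at `3`,
non-CM, `r_an = 1` ⟹ `BSD₃`»): the binder `¬ TowerSurjThree W` is «not onto mod `9`» by `not_towerSurjThree_iff`. CONDITIONAL on the
displayed hypothesis (the residual's content on the Elkies rows); nothing asserted. [cite: Elkies2006ThreeAdic, §0] -/
theorem wildRankOneSurjNonTowerAtThree_of_modNine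
    (h : ∀ (W : WeierstrassCurve ℚ) [W.IsElliptic] [W.IsGloballyMinimal], ¬ W.HasCM → ClassO6 W 3 →
      W.HasSurjectiveModNGaloisRep 3 → ¬ W.HasSurjectiveModNGaloisRep 9 → W.analyticRank = 1 → BSDp W 3) :
    WildRankOneSurjNonTowerAtThree := by
  intro W _ _ hCM hO6 hsurj hnt hr
  exact h W hCM hO6 hsurj ((not_towerSurjThree_iff W).mp hnt) hr

/-- **Conversely, NT BY NAME gives its census form** (the two are the same statement). [cite: Elkies2006ThreeAdic, §0] -/
theorem modNine_of_wildRankOneSurjNonTowerAtThree (h : WildRankOneSurjNonTowerAtThree)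
    (W : WeierstrassCurve ℚ) [W.IsElliptic] [W.IsGloballyMinimal] (hCM : ¬ W.HasCM) (hO6 : ClassO6 W 3)
    (hsurj : W.HasSurjectiveModNGaloisRep 3) (h9 : ¬ W.HasSurjectiveModNGaloisRep 9) (hr : W.analyticRank = 1) :
    BSDp W 3 :=
  h W hCM hO6 hsurj ((not_towerSurjThree_iff W).mpr h9) hr

end Summit.BirchSwinnertonDyer.BirchSwinnertonDyer.Theorems.TowerSurjThreeOfModNine

end
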